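import Literature.NumberTheory.QuadraticFields.BinaryQuadraticFormsClassNumberCountChunks
import HarnessLib

/-!
# Class number of `D = −114 148 483` by row chunks, file G3 of 5: rows `(3901, 4214] ↦ 28`, `(4214, 4504] ↦ 30`, `(4504, 4778] ↦ 26`

Topic `NumberTheory/QuadraticFields`, namespace `Literature.NumberTheory.QuadraticFields.Quadratic`; pure VALUES file (theorems only). The landau-siegel
rescue bed's deep negative ladder rung `D_83^− = −114 148 483` (= 101·463·2441; Lehmer–Lehmer–Shanks 1970) has
`h = 692` (engines A ≡ B of record). Its kernel evaluation by Cohen's Algorithm 5.3.5 (`BinQF.classNumberCount`,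
`BinaryQuadraticFormsClassNumberCount.lean`) needs ≈ 15 min of kernel time, beyond one declaration's budget (≈ 150 s) and one
file's (≈ 600 s), so the row range `1 ≤ a ≤ 6168` is cut into 15 chunks of roughly equal work (`BinQF.redRowsSumFrom`,
`BinaryQuadraticFormsClassNumberCountChunks.lean`), three per file; the assembly `BinQF.classNumber (−114148483) = 692` by
`BinQF.redRowsSumFrom_add` is in `ImaginaryQuadraticClassNumbersDeepI.lean`.

## References

* [Cohen1993] H. Cohen, *A Course in Computational Algebraic Number Theory*, GTM 138, §5.3.1 Algorithm 5.3.5.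
* [LehmerLehmerShanks1970] D. H. Lehmer, E. Lehmer, D. Shanks, Math. Comp. 24 (1970) 433–451, §1 and Table.
-/

namespace Literature.NumberTheory.QuadraticFields.Quadratic

/-- Row chunk `a ∈ (3901, 4214]` of Cohen's Algorithm 5.3.5 at `N = 114 148 483`: partial count `28` (one kernel evaluation).
[cite: Cohen1993, §5.3.1 Algorithm 5.3.5] -/
theorem redRowsSumFrom_114148483_3901 : BinQF.redRowsSumFrom 114148483 3901 313 = 28 := by
  decide +kernel

/-- Row chunk `a ∈ (4214, 4504]` of Cohen's Algorithm 5.3.5 at `N = 114 148 483`: partial count `30` (one kernel evaluation).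
[cite: Cohen1993, §5.3.1 Algorithm 5.3.5] -/
theorem redRowsSumFrom_114148483_4214 : BinQF.redRowsSumFrom 114148483 4214 290 = 30 := by
  decide +kernel

/-- Row chunk `a ∈ (4504, 4778]` of Cohen's Algorithm 5.3.5 at `N = 114 148 483`: partial count `26` (one kernel evaluation).
[cite: Cohen1993, §5.3.1 Algorithm 5.3.5] -/
theorem redRowsSumFrom_114148483_4504 : BinQF.redRowsSumFrom 114148483 4504 274 = 26 := by
  decide +kernel

end Literature.NumberTheory.QuadraticFields.Quadratic
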